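import Summits.HodgeConjecture.HodgeConjecture.Theorems.WeilTypeLadderSixfoldSlices
import Summits.HodgeConjecture.HodgeConjecture.Theorems.Ring2AbelianAllWeilCellsAnchored
import Summits.HodgeConjecture.HodgeConjecture.Theorems.Ring2HypothesesWeilDiscriminantHolds
import Summits.HodgeConjecture.HodgeConjecture.Theorems.Ring2AbelianAllWeilSignCells
import Summits.HodgeConjecture.HodgeConjecture.Theorems.Ring2AbelianAllLandherr
import Summits.HodgeConjecture.HodgeConjecture.Theorems.Ring2AbelianAllWeilAnchorCellsOnPath
import Summits.HodgeConjecture.HodgeConjecture.Theses.SplitImpliesAll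

/-! BC3 birth skeleton for crux `NonsplitSixfoldCells` (brief SplitImpliesAll) — LINE «up» = hsemireg's EightfoldBlochSeeds
inputs BY NAME (one item set wanted by both briefs): Deligne's reach (in print) ∧ Bloch's semiregular spreading theorem
(in print) ∧ ONE hyperbolic Bloch seed per `d` in dimension EIGHT (research input) ⟹ all `√-d`-sixfolds (DOOR A∘S[d],
kernel) ⟹ every sixfold cell ⟹ the variational instance on every non-split cell (ON-PATH converse, kernel).
Sorries ONLY inside `stub_*`. -/

set_option linter.dupNamespace false

namespace Summit.HodgeConjecture.HodgeConjecture.Cruxes.NonsplitSixfoldCells.Birth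

open Summit.HodgeConjecture.HodgeConjecture.Theses.SplitImpliesAll

/-- stub (in print: Deligne 1982 proof of Thm. 4.8 / van Geemen 1994 §5): reach of the hyperbolic Weil families. -/
theorem stub_reach : Literature.AlgebraicGeometry.HodgeTheory.weilFamilyReach_hyperbolic := by
  sorry

/-- stub (in print: Bloch 1972 Thm. (7.4) = Buchweitz–Flenner 2003 Thm. 5.2): semiregular classes spread over the
smooth locus of the family, ambient dimension 8, codimension 4. -/
theorem stub_spread : Literature.AlgebraicGeometry.HodgeTheory.BlochSemiregularSpread (2 * 4) 4 := by
  sorry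

/-- stub (RESEARCH INPUT, shared with hsemireg's «EightfoldBlochSeeds»): one hyperbolic Bloch seed per `d` on ONE
split `√-d`-Weil eightfold. -/
theorem stub_seed : ∀ d : ℕ, 0 < d → Literature.AlgebraicGeometry.HodgeTheory.HasHyperbolicBlochSeed 4 d := by
  sorry

/-- Composition (no sorry): the three stubs give the crux. -/
theorem NonsplitSixfoldCells_of
    (h₁ : Literature.AlgebraicGeometry.HodgeTheory.weilFamilyReach_hyperbolic)
    (h₂ : Literature.AlgebraicGeometry.HodgeTheory.BlochSemiregularSpread (2 * 4) 4)
    (h₃ : ∀ d : ℕ, 0 < d → Literature.AlgebraicGeometry.HodgeTheory.HasHyperbolicBlochSeed 4 d) :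
    Summit.HodgeConjecture.HodgeConjecture.Theses.SplitImpliesAll.NonsplitSixfoldCells := by
  have hW : Summit.HodgeConjecture.HodgeConjecture.Theses.SevenfoldWeilCensus.WeilSixfolds :=
    Summit.HodgeConjecture.HodgeConjecture.WeilTypeLadder.weilSixfolds_of_forall_slice fun d hd =>
      Summit.HodgeConjecture.HodgeConjecture.WeilTypeLadder.weilSixfolds_slice_of_reach_of_blochSpread_of_hyperbolicBlochSeed_four
        d hd h₁ h₂ (h₃ d hd)
  intro d hd δ _ _
  exact Summit.HodgeConjecture.HodgeConjecture.Ring2.AbelianAll.weilVariationalHodgeComponent_of_weilClassesComponent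
    (Summit.HodgeConjecture.HodgeConjecture.Ring2.Hypotheses.weilClassesComponent_three_of_weilSixfolds hW hd δ)

theorem NonsplitSixfoldCells_holds_of_stubs :
    Summit.HodgeConjecture.HodgeConjecture.Theses.SplitImpliesAll.NonsplitSixfoldCells :=
  NonsplitSixfoldCells_of stub_reach stub_spread stub_seed

/-- BC5 PLAN-ONLY RUNG (first non-split cell): the variational instance on the cell `(ℚ(√-3), 6, δ = [-2])` — the
tree's convention: `det H`-class `[-2]`, sign `-1 = (-1)^3`, `[-2] ≠ [-1] = split` since `2 ∉ Nm ℚ(√-3)`; this is the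
atlas's «(ℚ(√-3), (3,3), δ = 2)» cell containing the 6-dimensional type-II locus `𝔔(D₆)` on which the Weil classes are
algebraic FACT-FREE (`Ring2.AbelianAll.nonsplitSixfolds_of_plusPart_pow_ne_zero`). Technique named: germ at a type-II
member (positive-dimensional algebraic anchor locus, not CM-isolated) + countable-union-of-Hilbert-schemes locus lemma
(Charles–Schnell Prop. 11.3.11). Outside S's known regime: no non-split sixfold cell is closed in print. -/
theorem stub_rung_firstCell :
    Summit.HodgeConjecture.HodgeConjecture.Ring2.Hypotheses.WeilVariationalHodgeComponent 3 3
      (QuotientGroup.mk (Units.mk0 (-2 : ℚ) (by norm_num)) :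
        Literature.AlgebraicGeometry.VanGeemen1994.weilNormResidueGroup 3) := by
  sorry

/-- Sanity (kernel): the rung's cell is a genuine NON-split right-sign cell — its class has sign `-1`. -/
example : Summit.HodgeConjecture.HodgeConjecture.Ring2.AbelianAll.weilSign 3
    (QuotientGroup.mk (Units.mk0 (-2 : ℚ) (by norm_num)) :
      Literature.AlgebraicGeometry.VanGeemen1994.weilNormResidueGroup 3) = (-1) ^ 3 := by
  rw [Summit.HodgeConjecture.HodgeConjecture.Ring2.AbelianAll.weilSign_mk]
  exact (Summit.HodgeConjecture.HodgeConjecture.Ring2.AbelianAll.ratSign_eq_neg_one_pow_iff _ 3).2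
    (by rw [Units.val_mk0]; norm_num)

end Summit.HodgeConjecture.HodgeConjecture.Cruxes.NonsplitSixfoldCells.Birth
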